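import Summits.AtomisticToContinuum.HydrodynamicLimit.Theorems.AntiMazurCoboundariesCellForecastPressureDecayClusterTailCharging
import Summits.AtomisticToContinuum.HydrodynamicLimit.Theorems.AntiMazurCoboundariesCellForecastPressureDecayClusterTailInsertion
import Literature.Analysis.FluidPDE.HardSphereCollisionTimeMeasurable
import HarnessLib

/-!
# S2e-5(A) · assembly of the cluster tail, part A: pathwise lemmas and measurability of the counts
# (sub-goal of the registered stub `stub_clusterTail_assembly` of `stub_clusterTail`, crux line
# `enskog-compensator-martingale`, crux `CellForecastPressureDecay`, stmt-AtomisticToContinuum-13915)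

Pathwise facts on the good set of the whole-cell flow used by the assembly `stub_clusterTail_assembly`
(file `…ClusterTailAssembly`): symmetry and irreflexivity of the collision cylinder `InCylinder`, a free pair in the
cylinder DOES collide at its hitting time, the first-collision-time form of the event "the first contact of `i` is
non-fresh" and the (a.e.-)measurability of the two counts that the assembly has to ADD (lower Lebesgue integrals are
additive only on a.e.-measurable functions): the non-fresh count (through the measurable enumerated collision times
`HardSphereFlow.nthCollisionTimeOf`, `HardSphereCollisionTimeMeasurable`) and the static double-cylinder count
(through the measurable cylinder relation of `…ClusterTailCharging`).

References: Gallagher–Saint-Raymond–Texier 2013, §4.1; Cercignani–Illner–Pulvirenti 1994, §2.2, §4.2.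
-/

noncomputable section

open MeasureTheory ProbabilityTheory Set Filter Topology
open scoped ENNReal BigOperators InnerProductSpace
open Literature.Analysis.FluidPDE Literature.MathematicalPhysics.KineticTheory

namespace Summit.AtomisticToContinuum.HydrodynamicLimit.Theorems.EnskogCompensator

/-! ## The collision cylinder: symmetry, irreflexivity, hitting-time form -/

/-- The collision cylinder relation is symmetric in the two labels (`ω ↦ −ω`), `iff` form. [cite: CIP1994, §2.2] -/
theorem inCylinder_comm {σ Δ : ℝ} {n : ℕ} {z : Cell n} {i j : Fin n} : InCylinder σ Δ z i j ↔ InCylinder σ Δ z j i := by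
  suffices h : ∀ {i j : Fin n}, InCylinder σ Δ z i j → InCylinder σ Δ z j i from ⟨h, h⟩
  intro i j h
  obtain ⟨ω, t, ht, hin, hq⟩ := h
  have hω : ‖-(ω : V3)‖ = 1 := by rw [norm_neg]; simp
  refine ⟨⟨-(ω : V3), mem_sphere_zero_iff_norm.2 hω⟩, t, ht, ?_, ?_⟩
  · change inner ℝ (-(ω : V3)) ((z j).2 - (z i).2) < 0
    rwa [inner_neg_left, ← neg_sub, inner_neg_right, neg_neg]
  · change (z j).1 - (z i).1 = σ • (-(ω : V3)) - t • ((z j).2 - (z i).2)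
    rw [← neg_sub, hq, ← neg_sub (z i).2, smul_neg, smul_neg]
    abel

/-- No label is in the collision cylinder of itself (the relative velocity vanishes). [folklore] -/
theorem InCylinder.ne {σ Δ : ℝ} {n : ℕ} {z : Cell n} {i j : Fin n} (h : InCylinder σ Δ z i j) : i ≠ j := by
  rintro rfl
  obtain ⟨ω, t, -, hin, -⟩ := h
  rw [sub_self, inner_zero_right] at hin
  exact lt_irrefl _ hin

/-- The collision cylinder in hitting-time form, for the initial data of a pair. [cite: CIP1994, §2.2] -/
theorem inCylinder_iff_pairHits {σ : ℝ} (hσ : 0 < σ) (Δ : ℝ) {n : ℕ} (z : Cell n) (i j : Fin n) :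
    InCylinder σ Δ z i j ↔
      PairHits σ ((z i).1 - (z j).1) ((z i).2 - (z j).2) ∧ 0 < pairDisc σ ((z i).1 - (z j).1) ((z i).2 - (z j).2) ∧
        pairHitTime σ ((z i).1 - (z j).1) ((z i).2 - (z j).2) ∈ Ioc 0 Δ :=
  exists_cylinder_iff_pairHits hσ Δ _ _

/-! ## A free pair in the cylinder collides at its hitting time -/

/-- **A free pair in the cylinder does collide.** Along the whole-cell flow of a good datum, if the free two-body
motion of `p ≠ q` hits at the time `t* > 0` (`PairHits`, `t* = pairHitTime`) and neither sphere takes part in a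
collision at the times of `(0, t*)`, then `p` and `q` are in contact (collide) at time `t*`: both flew freely, and
positions are continuous. [cite: GST2013, §4.1 Def. 4.1.2] -/
theorem collide_of_free_pairHits {σ : ℝ} (hσ : 0 < σ) {n : ℕ} (Ψ : Flows σ) {z : Cell n} (hz : z ∈ (Ψ n).good)
    {p q : Fin n} (hpq : p ≠ q) (hhits : PairHits σ ((z p).1 - (z q).1) ((z p).2 - (z q).2))
    (hpos : 0 < pairHitTime σ ((z p).1 - (z q).1) ((z p).2 - (z q).2))
    (hp : ∀ s ∈ Ioo 0 (pairHitTime σ ((z p).1 - (z q).1) ((z p).2 - (z q).2)),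
      ¬ Participates (Euclidean.geometry (Fin 3)) σ ((Ψ n).flow s z) p)
    (hq : ∀ s ∈ Ioo 0 (pairHitTime σ ((z p).1 - (z q).1) ((z p).2 - (z q).2)),
      ¬ Participates (Euclidean.geometry (Fin 3)) σ ((Ψ n).flow s z) q) :
    Collide (Euclidean.geometry (Fin 3)) σ
      ((Ψ n).flow (pairHitTime σ ((z p).1 - (z q).1) ((z p).2 - (z q).2)) z) p q := by
  set T := pairHitTime σ ((z p).1 - (z q).1) ((z p).2 - (z q).2) with hT
  have htraj := (Ψ n).isTrajectory z hz
  have h0 : (Ψ n).flow 0 z = z := (Ψ n).flow_zero z hz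
  have hxp := fst_eq_of_forall_not_participates_Ioo htraj hpos hp
  have hxq := fst_eq_of_forall_not_participates_Ioo htraj hpos hq
  simp only [h0, sub_zero] at hxp hxq
  have hc : (Ψ n).flow T z ∈ contactSet (Euclidean.geometry (Fin 3)) n σ p q := by
    refine mem_contactSet.2 ⟨htraj.mem T, ?_⟩
    rw [Euclidean.geometry_sepVec, hxp, hxq, sub_add_smul_sub]
    exact norm_add_pairHitTime_smul hσ.le hhits
  exact Or.inl (mem_contactPairs.2 ⟨hpq, hc⟩)


/-! ## The first collision time of a sphere after time `0` along the whole-cell flow -/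

section FirstTime

variable {σ : ℝ} {n : ℕ} (Ψ : Flows σ) {z : Cell n}

/-- The first collision time of `i` after `0` is positive iff `i` collides at some positive time. [folklore] -/
theorem nthCollisionTimeOf_zero_pos_iff (hz : z ∈ (Ψ n).good) (i : Fin n) :
    0 < (Ψ n).nthCollisionTimeOf i 0 z ↔
      (collisionTimesOf (Euclidean.geometry (Fin 3)) σ (fun t => (Ψ n).flow t z) i ∩ Ioi 0).Nonempty := by
  refine ⟨fun hpos => ?_, fun hne => (((Ψ n).isTrajectory z hz).isLeast_nthCollisionTimeOf_zero hne).1.2⟩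
  by_contra hne
  rw [not_nonempty_iff_eq_empty] at hne
  exact hpos.ne' (nextTimeAfter_of_eq_empty hne)

/-- If `i` collides at a positive time `s`, its first collision time after `0` is in `(0, s]`, `i` participates
at it and not strictly before. [folklore] -/
theorem nthCollisionTimeOf_zero_spec (hz : z ∈ (Ψ n).good) {i : Fin n} {s : ℝ} (hs : 0 < s)
    (hp : Participates (Euclidean.geometry (Fin 3)) σ ((Ψ n).flow s z) i) :
    0 < (Ψ n).nthCollisionTimeOf i 0 z ∧ (Ψ n).nthCollisionTimeOf i 0 z ≤ s ∧
      Participates (Euclidean.geometry (Fin 3)) σ ((Ψ n).flow ((Ψ n).nthCollisionTimeOf i 0 z) z) i ∧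
      ∀ s' ∈ Ioo 0 ((Ψ n).nthCollisionTimeOf i 0 z),
        ¬ Participates (Euclidean.geometry (Fin 3)) σ ((Ψ n).flow s' z) i := by
  have hl := ((Ψ n).isTrajectory z hz).isLeast_nthCollisionTimeOf_zero (a := 0) (k := i) ⟨s, hp, hs⟩
  exact ⟨hl.1.2, hl.2 ⟨hp, hs⟩, hl.1.1, fun s' hs' hp' => (not_lt.2 (hl.2 ⟨hp', hs'.1⟩)) hs'.2⟩

/-- A positive first collision time is attained: `i` participates at it and not strictly before. [folklore] -/
theorem nthCollisionTimeOf_zero_spec_of_pos (hz : z ∈ (Ψ n).good) {i : Fin n}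
    (hpos : 0 < (Ψ n).nthCollisionTimeOf i 0 z) :
    Participates (Euclidean.geometry (Fin 3)) σ ((Ψ n).flow ((Ψ n).nthCollisionTimeOf i 0 z) z) i ∧
      ∀ s' ∈ Ioo 0 ((Ψ n).nthCollisionTimeOf i 0 z),
        ¬ Participates (Euclidean.geometry (Fin 3)) σ ((Ψ n).flow s' z) i := by
  obtain ⟨s, hp, hs⟩ := (nthCollisionTimeOf_zero_pos_iff Ψ hz i).1 hpos
  have h := nthCollisionTimeOf_zero_spec Ψ hz hs hp
  exact ⟨h.2.2.1, h.2.2.2⟩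

/-- The first participation time is the first collision time: if `i` participates at `s > 0` and not on `(0, s)`,
then `s` is its first collision time after `0`. [folklore] -/
theorem nthCollisionTimeOf_zero_eq (hz : z ∈ (Ψ n).good) {i : Fin n} {s : ℝ} (hs : 0 < s)
    (hp : Participates (Euclidean.geometry (Fin 3)) σ ((Ψ n).flow s z) i)
    (hfree : ∀ s' ∈ Ioo 0 s, ¬ Participates (Euclidean.geometry (Fin 3)) σ ((Ψ n).flow s' z) i) :
    (Ψ n).nthCollisionTimeOf i 0 z = s := by
  obtain ⟨hpos, hle, hpart, -⟩ := nthCollisionTimeOf_zero_spec Ψ hz hs hp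
  rcases hle.eq_or_lt with h | h
  · exact h
  · exact absurd hpart (hfree _ ⟨hpos, h⟩)

/-- **The non-fresh first contact in first-collision-time form.** On the good set, "`i` is free on `(0, s)`,
collides at `s ∈ (0, Δ]` with `j ≠ i`, and `j` already took part in a collision at a time of `(0, s)`" says exactly:
the first collision time `Tᵢ` of `i` lies in `(0, Δ]`, `i` collides with `j` at `Tᵢ`, and `0 < Tⱼ < Tᵢ`. [folklore] -/
theorem nonFresh_iff (hz : z ∈ (Ψ n).good) (i : Fin n) (Δ : ℝ) :
    (∃ j : Fin n, j ≠ i ∧ ∃ s ∈ Set.Ioc 0 Δ, Collide (Euclidean.geometry (Fin 3)) σ ((Ψ n).flow s z) i j ∧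
        (∀ s' ∈ Set.Ioo 0 s, ¬ Participates (Euclidean.geometry (Fin 3)) σ ((Ψ n).flow s' z) i) ∧
        (∃ s' ∈ Set.Ioo 0 s, Participates (Euclidean.geometry (Fin 3)) σ ((Ψ n).flow s' z) j)) ↔
      (Ψ n).nthCollisionTimeOf i 0 z ∈ Set.Ioc 0 Δ ∧ ∃ j : Fin n, j ≠ i ∧
        Collide (Euclidean.geometry (Fin 3)) σ ((Ψ n).flow ((Ψ n).nthCollisionTimeOf i 0 z) z) i j ∧
        (Ψ n).nthCollisionTimeOf j 0 z ∈ Set.Ioo 0 ((Ψ n).nthCollisionTimeOf i 0 z) := by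
  constructor
  · rintro ⟨j, hji, s, hs, hc, hfree, s', hs', hpj⟩
    have hTi : (Ψ n).nthCollisionTimeOf i 0 z = s := nthCollisionTimeOf_zero_eq Ψ hz hs.1 ⟨j, hc⟩ hfree
    obtain ⟨hTj0, hTjle, -, -⟩ := nthCollisionTimeOf_zero_spec Ψ hz hs'.1 hpj
    rw [hTi]
    exact ⟨hs, j, hji, hc, hTj0, hTjle.trans_lt hs'.2⟩
  · rintro ⟨hTi, j, hji, hc, hTj⟩
    obtain ⟨-, hfree⟩ := nthCollisionTimeOf_zero_spec_of_pos Ψ hz hTi.1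
    obtain ⟨hpj, -⟩ := nthCollisionTimeOf_zero_spec_of_pos Ψ hz hTj.1
    exact ⟨j, hji, _, hTi, hc, hfree, _, hTj, hpj⟩

end FirstTime

/-! ## Measurability of the two counts that the assembly adds -/

section Measurability

variable {σ : ℝ} {n : ℕ}

/-- The event "`i` and `j` collide" is a measurable set of configurations (Euclidean geometry). [folklore] -/
theorem measurableSet_collide (σ : ℝ) (n : ℕ) (i j : Fin n) :
    MeasurableSet {c : Cell n | Collide (Euclidean.geometry (Fin 3)) σ c i j} := by
  have h1 := measurableSet_contactSet (Euclidean.geometry (Fin 3)) Euclidean.measurable_geometry_sepVec n σ i j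
  have h2 := measurableSet_contactSet (Euclidean.geometry (Fin 3)) Euclidean.measurable_geometry_sepVec n σ j i
  have hset : {c : Cell n | Collide (Euclidean.geometry (Fin 3)) σ c i j} =
      {c | i ≠ j ∧ c ∈ contactSet (Euclidean.geometry (Fin 3)) n σ i j} ∪
        {c | j ≠ i ∧ c ∈ contactSet (Euclidean.geometry (Fin 3)) n σ j i} := by
    ext c
    simp only [mem_setOf_eq, Collide, mem_contactPairs, mem_union]
  rw [hset]
  exact ((MeasurableSet.const _).inter h1).union ((MeasurableSet.const _).inter h2)

/-- The Euclidean separation distance is continuous. [folklore] -/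
theorem continuous_norm_euclidean_sepVec :
    Continuous fun p : V3 × V3 => ‖(Euclidean.geometry (Fin 3)).sepVec p.1 p.2‖ := by
  change Continuous fun p : V3 × V3 => ‖p.1 - p.2‖
  fun_prop

open Classical in
/-- **The non-fresh count is measurable on the good set**: through `nonFresh_iff` it is a finite Boolean
combination of the measurable first collision times `HardSphereFlow.nthCollisionTimeOf · 0` and of the measurable
configurations at those times (`HardSphereCollisionTimeMeasurable`). [folklore] -/
theorem measurable_card_nonFresh (Ψ : Flows σ) (Δ : ℝ) :
    Measurable fun z : (Ψ n).good => (((Finset.univ.filter fun i : Fin n => ∃ j : Fin n, j ≠ i ∧ ∃ s ∈ Set.Ioc 0 Δ,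
      Collide (Euclidean.geometry (Fin 3)) σ ((Ψ n).flow s (z : Cell n)) i j ∧
      (∀ s' ∈ Set.Ioo 0 s, ¬ Participates (Euclidean.geometry (Fin 3)) σ ((Ψ n).flow s' (z : Cell n)) i) ∧
      (∃ s' ∈ Set.Ioo 0 s, Participates (Euclidean.geometry (Fin 3)) σ ((Ψ n).flow s' (z : Cell n)) j)).card : ℕ) :
        ℝ≥0∞) := by
  set T : Fin n → (Ψ n).good → ℝ := fun k z => (Ψ n).nthCollisionTimeOf k 0 (z : Cell n) with hTdef
  have hT : ∀ k, Measurable (T k) := fun k =>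
    (Ψ n).measurable_nthCollisionTimeOf_comp_subtype continuous_norm_euclidean_sepVec
      Euclidean.measurable_geometry_sepVec k 0
  have hZ : ∀ k, Measurable fun z : (Ψ n).good => (Ψ n).flow (T k z) (z : Cell n) := fun k =>
    (Ψ n).measurable_flow_nthCollisionTimeOf_comp_subtype continuous_euclidean_translate
      continuous_norm_euclidean_sepVec Euclidean.measurable_geometry_sepVec k 0
  set Q : Fin n → (Ψ n).good → Prop := fun i z => T i z ∈ Set.Ioc 0 Δ ∧ ∃ j : Fin n, j ≠ i ∧
    Collide (Euclidean.geometry (Fin 3)) σ ((Ψ n).flow (T i z) (z : Cell n)) i j ∧ T j z ∈ Set.Ioo 0 (T i z) with hQdef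
  have hQ : ∀ i, Measurable (Q i) := by
    intro i
    refine (measurableSet_setOf.1 ((hT i) measurableSet_Ioc)).and (Measurable.exists fun j => ?_)
    refine measurable_const.and ((measurableSet_setOf.1 ((hZ i) (measurableSet_collide σ n i j))).and ?_)
    exact (measurableSet_setOf.1 (measurableSet_lt measurable_const (hT j))).and
      (measurableSet_setOf.1 (measurableSet_lt (hT j) (hT i)))
  have heq : (fun z : (Ψ n).good => (((Finset.univ.filter fun i : Fin n => ∃ j : Fin n, j ≠ i ∧ ∃ s ∈ Set.Ioc 0 Δ,
      Collide (Euclidean.geometry (Fin 3)) σ ((Ψ n).flow s (z : Cell n)) i j ∧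
      (∀ s' ∈ Set.Ioo 0 s, ¬ Participates (Euclidean.geometry (Fin 3)) σ ((Ψ n).flow s' (z : Cell n)) i) ∧
      (∃ s' ∈ Set.Ioo 0 s, Participates (Euclidean.geometry (Fin 3)) σ ((Ψ n).flow s' (z : Cell n)) j)).card : ℕ) :
        ℝ≥0∞)) = fun z => ∑ i : Fin n, if Q i z then (1 : ℝ≥0∞) else 0 := by
    funext z
    rw [Finset.card_filter]
    push_cast
    exact Finset.sum_congr rfl fun i _ => if_congr (nonFresh_iff Ψ z.2 i Δ) rfl rfl
  rw [heq]
  exact Finset.measurable_sum _ fun i _ => Measurable.ite (hQ i).setOf measurable_const measurable_const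

open Classical in
/-- The non-fresh count is a.e.-measurable for the cell law (which is carried by the good set). [folklore] -/
theorem aemeasurable_card_nonFresh (σ L : ℝ) (n : ℕ) (Ψ : Flows σ) (Δ : ℝ) :
    AEMeasurable (fun z : Cell n => (((Finset.univ.filter fun i : Fin n => ∃ j : Fin n, j ≠ i ∧ ∃ s ∈ Set.Ioc 0 Δ,
      Collide (Euclidean.geometry (Fin 3)) σ ((Ψ n).flow s z) i j ∧
      (∀ s' ∈ Set.Ioo 0 s, ¬ Participates (Euclidean.geometry (Fin 3)) σ ((Ψ n).flow s' z) i) ∧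
      (∃ s' ∈ Set.Ioo 0 s, Participates (Euclidean.geometry (Fin 3)) σ ((Ψ n).flow s' z) j)).card : ℕ) : ℝ≥0∞))
      (cellLaw σ L n Ψ) :=
  (Ψ n).aemeasurable_of_measurable_comp_subtype (measurable_card_nonFresh Ψ Δ)
    (mem_ae_iff.1 (ae_mem_good_cellLaw σ L n Ψ))

/-- The event "the initial data of `(i, j)` lie in the collision cylinder of the slab" is measurable. [folklore] -/
theorem measurableSet_inCylinder (hσ : 0 < σ) (Δ : ℝ) (i j : Fin n) :
    MeasurableSet {z : Cell n | InCylinder σ Δ z i j} := by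
  have hset : {z : Cell n | InCylinder σ Δ z i j} = (fun z : Cell n => ((z i).1 - (z j).1, (z i).2 - (z j).2)) ⁻¹'
      {p : V3 × V3 | PairHits σ p.1 p.2 ∧ 0 < pairDisc σ p.1 p.2 ∧ pairHitTime σ p.1 p.2 ∈ Ioc 0 Δ} := by
    ext z
    exact inCylinder_iff_pairHits hσ Δ z i j
  rw [hset]
  refine (measurableSet_cylRel σ Δ).preimage ?_
  exact (((measurable_pi_apply i).fst).sub ((measurable_pi_apply j).fst)).prodMk
    (((measurable_pi_apply i).snd).sub ((measurable_pi_apply j).snd))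

open Classical in
/-- **The double-cylinder count is measurable** (a static event of the initial data). [folklore] -/
theorem measurable_card_doubleCylinder (hσ : 0 < σ) (n : ℕ) (Δ : ℝ) :
    Measurable fun z : Cell n => (((Finset.univ.filter fun t : Fin n × Fin n × Fin n =>
      t.1 ≠ t.2.1 ∧ t.1 ≠ t.2.2 ∧ t.2.1 ≠ t.2.2 ∧ InCylinder σ Δ z t.1 t.2.1 ∧ InCylinder σ Δ z t.1 t.2.2).card : ℕ) :
        ℝ≥0∞) := by
  have hQ : ∀ t : Fin n × Fin n × Fin n, Measurable fun z : Cell n =>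
      t.1 ≠ t.2.1 ∧ t.1 ≠ t.2.2 ∧ t.2.1 ≠ t.2.2 ∧ InCylinder σ Δ z t.1 t.2.1 ∧ InCylinder σ Δ z t.1 t.2.2 := fun t =>
    measurable_const.and (measurable_const.and (measurable_const.and
      ((measurableSet_setOf.1 (measurableSet_inCylinder hσ Δ t.1 t.2.1)).and
        (measurableSet_setOf.1 (measurableSet_inCylinder hσ Δ t.1 t.2.2)))))
  have heq : (fun z : Cell n => (((Finset.univ.filter fun t : Fin n × Fin n × Fin n =>
      t.1 ≠ t.2.1 ∧ t.1 ≠ t.2.2 ∧ t.2.1 ≠ t.2.2 ∧ InCylinder σ Δ z t.1 t.2.1 ∧ InCylinder σ Δ z t.1 t.2.2).card : ℕ) :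
        ℝ≥0∞)) = fun z => ∑ t : Fin n × Fin n × Fin n,
        if t.1 ≠ t.2.1 ∧ t.1 ≠ t.2.2 ∧ t.2.1 ≠ t.2.2 ∧ InCylinder σ Δ z t.1 t.2.1 ∧ InCylinder σ Δ z t.1 t.2.2
        then (1 : ℝ≥0∞) else 0 := by
    funext z
    rw [Finset.card_filter]
    push_cast
    rfl
  rw [heq]
  exact Finset.measurable_sum _ fun t _ => Measurable.ite (hQ t).setOf measurable_const measurable_const

end Measurability


/-! ## The registered sub-goal of this file -/

open Classical in
/-- **Registered sub-goal `stub_clusterTail_assembly_measurable`** (piece of `stub_clusterTail_assembly`, S2e-5, of the line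
`enskog-compensator-martingale`): the two counts that the assembly of the cluster tail adds to the disturbed-fresh-pair count
are (a.e.-)measurable — the number of spheres whose first contact in the slab is non-fresh (for the cell law, which is carried
by the good set of the whole-cell flow), and the number of ordered double cylinders of the initial data. [folklore] -/
theorem stub_clusterTail_assembly_measurable :
    (∀ (σ L : ℝ) (n : ℕ) (Ψ : Flows σ) (Δ : ℝ), AEMeasurable (fun z : Cell n => ((Finset.univ.filter fun i : Fin n =>
      ∃ j : Fin n, j ≠ i ∧ ∃ s ∈ Set.Ioc 0 Δ, Collide (Euclidean.geometry (Fin 3)) σ ((Ψ n).flow s z) i j ∧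
        (∀ s' ∈ Set.Ioo 0 s, ¬ Participates (Euclidean.geometry (Fin 3)) σ ((Ψ n).flow s' z) i) ∧
        (∃ s' ∈ Set.Ioo 0 s, Participates (Euclidean.geometry (Fin 3)) σ ((Ψ n).flow s' z) j)).card : ℝ≥0∞))
      (cellLaw σ L n Ψ)) ∧
    (∀ σ : ℝ, 0 < σ → ∀ (n : ℕ) (Δ : ℝ), Measurable fun z : Cell n => ((Finset.univ.filter fun t : Fin n × Fin n × Fin n =>
      t.1 ≠ t.2.1 ∧ t.1 ≠ t.2.2 ∧ t.2.1 ≠ t.2.2 ∧ InCylinder σ Δ z t.1 t.2.1 ∧ InCylinder σ Δ z t.1 t.2.2).card : ℝ≥0∞)) :=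
  ⟨fun σ L n Ψ Δ => aemeasurable_card_nonFresh σ L n Ψ Δ, fun _ hσ n Δ => measurable_card_doubleCylinder hσ n Δ⟩

end Summit.AtomisticToContinuum.HydrodynamicLimit.Theorems.EnskogCompensator

end
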